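import Summits.Ventures.HSemireg.WedgeApolarPairing
import Summits.Ventures.HSemireg.WedgeHankelCoSiegel
import Summits.Ventures.HSemireg.WedgeHankelSubstitutionParabolic

/-!
# Venture HSemireg — THE APOLAR PAIRING ON TH-7's SPIKE BASIS: `apolar_m(δ_p, δ_{p′}) = [p + p′ = m]·(−1)^{m(m−1)/2}·(−1)^p·C(m,p)` (so `E_p ∧ E_{p′} ≠ 0` iff `p + p′ = n` and `C(n,p) ≠ 0`
# in `K`), the expansion `apolar_n(q, q′) = Σ_p q_p · apolar_n(δ_p, q′)`, NON-DEGENERACY when every `C(n,p)` is a unit, and then **no class is a Siegel form: `coSiegel_n ∩ SI_n = 0`**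
# (in characteristic `2`, by contrast, `E_1 = x₀y₁ + x₁y₀` IS the Siegel vector `s_{01}`)

HONEST FRAMING. Part of the Lean index of the computation cell `pub-hsemireg` (seat p10 gen 19, Sunday typer «UNIFORM-IN-n»).
Finite-dimensional EXTERIOR ALGEBRA over a field ONLY: no variety, no cohomology theory, no sheaf, no Ext group, no semiregularity map;
nothing here says that HC / HC_CM / HC_AV holds; no Literature fact is declared or used.  Custodian versions as in `WedgeHankelSiegelIdeal` (1/3); the dictionary (the apolar pairing of binary
forms; `E_p = Θ^p/p!`) is QUOTED, never asserted.

WHAT IS IN THE TREE.  I14 `WedgeApolarPairing` (964): `apolar` by th-7's recursion, bilinearity, `apolar_swap`, **`w_mul_w`** (`w_m(q) ∧ w_m(q′) = apolar_m(q,q′)·Π`), `w_mul_w_eq_zero_iff`,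
`topCoeff_w_mul_w`; gen 11 `shift_spike_succ` / `shift_spike_zero`; G6 `siegelIdeal_eq_Ann_coSiegel` (`SI_k = Ann_k(coSiegel(2n−k))`), E1 `mem_Ann`; F9 `coSiegel_n_eq_span_w`, I8
`exists_eq_w_of_mem_coSiegel`.  THIS FILE (namespace `Summit.Ventures.HSemireg.Wedge.KernelDuality` continued):
* §203 `apolar_congr` (only the windows `[0, m]` matter), `apolar_zero_seq_left/_right`; **`apolar_spike_spike`: `apolar m δ_p δ_{p′} = if p + p′ = m then (−1)^{m(m−1)/2}·(−1)^p·C(m,p)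
  else 0`** (induction on the recursion with Pascal's rule; the sign `(−1)^{m(m−1)/2}` via `triangle_succ`); hence **`w_spike_mul_w_spike_eq_zero_iff`** (`E_p ∧ E_{p′} = 0 ⇔ p + p′ ≠ n
  ∨ C(n,p) = 0` in `K`) and `w_spike_mul_w_spike_ne_zero` (`p + p′ = n`, `C(n,p) ≠ 0` in `K`).
* §204 `apolar_finset_sum_left`, **`apolar_eq_sum_spike_left`: `apolar m q q′ = Σ_{p ≤ m} q_p · apolar m δ_p q′`**, **`apolar_spike_right`: `apolar m q δ_{p′} = (−1)^{m(m−1)/2} (−1)^{m−p′}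
  C(m, m−p′) q_{m−p′}`** for `p′ ≤ m` — so **`apolar_nondegenerate`**: if every `C(m,p)` (`p ≤ m`) is non-zero in `K` and `q ≢ 0` on `[0,m]`, some spike `δ_{p′}` pairs non-trivially with `q`.
* §205 **`coSiegel_inf_siegelIdeal_eq_bot`: if every `C(n,p)` is a unit in `K` then `coSiegel_n ⊓ SI_n = ⊥`** — no non-zero class `w_n(q)` is a Siegel form (G6: `SI_n = Ann_n(coSiegel_n)`, and a
  class annihilating all classes is apolar to every spike); `w_mem_siegelIdeal_iff_window_zero`.  (In characteristic `p ≤ n` this fails: `char 2`, `n = 2`: `E_1 = s_{01}`.)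
NOT typed here: the closed form `apolar m q q′ = (−1)^{m(m−1)/2} Σ_p (−1)^p C(m,p) q_p q′_{m−p}` as ONE `Finset.sum` (it is `apolar_eq_sum_spike_left` + `apolar_spike_right`, two lines away);
the characteristic-`p` structure of `coSiegel_n ∩ SI_n`; anything Ext-side.  New names only.
-/

open Module

namespace Summit.Ventures.HSemireg.Wedge.KernelDuality

open Summit.Ventures.HSemireg.Wedge Summit.Ventures.HSemireg.Wedge.Kunneth Summit.Ventures.HSemireg.Wedge.Hankel
  Summit.Ventures.HSemireg.Wedge.KunnethKernel Summit.Ventures.HSemireg.Wedge.HankelFrameChange Summit.Ventures.HSemireg.Wedge.HankelSiegel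
  Summit.Ventures.HSemireg.Wedge.HankelSiegelIdeal Summit.Ventures.HSemireg.Wedge.HankelRankOne

variable (K : Type*) [Field K] {n : ℕ}

/-! ## §203. The pairing on spikes -/

/-- the pairing in degree `m` reads only the windows `[0, m]`. -/
theorem apolar_congr : ∀ (m : ℕ) {q₁ q₂ q₁' q₂' : ℕ → K}, (∀ j ≤ m, q₁ j = q₂ j) → (∀ j ≤ m, q₁' j = q₂' j) → apolar K m q₁ q₁' = apolar K m q₂ q₂'
  | 0, _, _, _, _, h, h' => by rw [apolar_zero, apolar_zero, h 0 le_rfl, h' 0 le_rfl]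
  | m + 1, q₁, q₂, q₁', q₂', h, h' => by
    rw [apolar_succ, apolar_succ,
      apolar_congr m (q₁ := q₁) (q₂ := q₂) (q₁' := shift K q₁') (q₂' := shift K q₂') (fun j hj => h j (by omega)) (fun j hj => h' (j + 1) (by omega)),
      apolar_congr m (q₁ := shift K q₁) (q₂ := shift K q₂) (q₁' := q₁') (q₂' := q₂') (fun j hj => h (j + 1) (by omega)) (fun j hj => h' j (by omega))]

/-- `apolar m 0 q′ = 0`. -/
lemma apolar_zero_seq_left (m : ℕ) (q' : ℕ → K) : apolar K m (fun _ => 0) q' = 0 := by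
  have h := apolar_smul_left K 0 m (fun _ => (0 : K)) q'
  simp only [mul_zero, zero_mul] at h
  exact h

/-- `apolar m q 0 = 0`. -/
lemma apolar_zero_seq_right (m : ℕ) (q : ℕ → K) : apolar K m q (fun _ => 0) = 0 := by
  have h := apolar_smul_right K 0 m q (fun _ => (0 : K))
  simp only [mul_zero, zero_mul] at h
  exact h

/-- the triangular numbers step: `(m+1)m/2 = m(m−1)/2 + m`. -/
private lemma triangle_succ (m : ℕ) : (m + 1) * m / 2 = m * (m - 1) / 2 + m := by
  rcases m with _ | k
  · simp
  · rw [Nat.add_sub_cancel, show (k + 1 + 1) * (k + 1) = (k + 1) * k + 2 * (k + 1) by ring, Nat.add_mul_div_left _ _ two_pos]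

/-- the sign step: `(−1)^m · (−1)^{m(m−1)/2} = (−1)^{(m+1)m/2}`. -/
private lemma sign_succ (m : ℕ) : (-1 : K) ^ m * (-1) ^ (m * (m - 1) / 2) = (-1) ^ ((m + 1) * m / 2) := by
  rw [triangle_succ, pow_add, mul_comm]

/-- **THE PAIRING ON SPIKES: `apolar m δ_p δ_{p′} = [p + p′ = m] · (−1)^{m(m−1)/2} · (−1)^p · C(m,p)`** (Pascal's rule along th-7's recursion). -/
theorem apolar_spike_spike : ∀ (m p p' : ℕ),
    apolar K m (fun j => if j = p then (1 : K) else 0) (fun j => if j = p' then (1 : K) else 0) =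
      if p + p' = m then (-1) ^ (m * (m - 1) / 2) * (-1) ^ p * (m.choose p : K) else 0
  | 0, p, p' => by
    rw [apolar_zero]
    by_cases hp : p = 0
    · by_cases hp' : p' = 0
      · subst hp hp'; simp
      · subst hp; rw [if_pos rfl, if_neg (Ne.symm hp'), mul_zero, if_neg (by omega)]
    · rw [if_neg (Ne.symm hp), zero_mul, if_neg (by omega)]
  | m + 1, p, p' => by
    rw [apolar_succ]
    rcases p with _ | p
    · -- `p = 0`: `σδ_0 = 0`
      rcases p' with _ | p'
      · rw [shift_spike_zero, apolar_zero_seq_left, apolar_zero_seq_right, sub_zero, mul_zero, if_neg (by omega)]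
      · rw [shift_spike_zero, apolar_zero_seq_left, sub_zero, shift_spike_succ K p', apolar_spike_spike m 0 p']
        simp only [Nat.choose_zero_right, Nat.cast_one, mul_one, pow_zero, Nat.zero_add]
        by_cases h : p' = m
        · subst h; rw [if_pos rfl, if_pos rfl, Nat.add_sub_cancel, sign_succ]
        · rw [if_neg h, if_neg (by omega), mul_zero]
    · rcases p' with _ | p'
      · -- `p′ = 0`: `σδ_0 = 0`
        rw [shift_spike_zero, apolar_zero_seq_right, zero_sub, shift_spike_succ K p, apolar_spike_spike m p 0]
        simp only [Nat.add_zero]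
        by_cases h : p = m
        · subst h
          rw [if_pos rfl, if_pos rfl, Nat.add_sub_cancel, Nat.choose_self, Nat.choose_self, Nat.cast_one, mul_one, mul_one, ← sign_succ K p, pow_succ (-1 : K) p]
          ring
        · rw [if_neg h, if_neg (by omega), neg_zero, mul_zero]
      · rw [shift_spike_succ K p', shift_spike_succ K p, apolar_spike_spike m (p + 1) p', apolar_spike_spike m p (p' + 1)]
        by_cases h : p + 1 + (p' + 1) = m + 1
        · rw [if_pos (show p + 1 + p' = m by omega), if_pos (show p + (p' + 1) = m by omega), if_pos h, Nat.add_sub_cancel, ← sign_succ K m, Nat.choose_succ_succ',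
            Nat.cast_add, pow_succ (-1 : K) p]
          ring
        · rw [if_neg (by omega), if_neg (by omega), if_neg h, sub_zero, mul_zero]

/-- **`E_p ∧ E_{p′} = 0` IFF `p + p′ ≠ n` OR `C(n,p) = 0` in `K`** (th-7's spike classes `E_p = w_n(δ_p)`). -/
theorem w_spike_mul_w_spike_eq_zero_iff (p p' : ℕ) :
    w K n n (fun j => if j = p then (1 : K) else 0) * w K n n (fun j => if j = p' then (1 : K) else 0) = 0 ↔ p + p' ≠ n ∨ (n.choose p : K) = 0 := by
  rw [w_mul_w_eq_zero_iff, apolar_spike_spike]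
  by_cases h : p + p' = n
  · rw [if_pos h]
    simp only [mul_eq_zero, pow_eq_zero_iff', neg_eq_zero, one_ne_zero, ne_eq, false_and, false_or, h, not_true_eq_false]
  · rw [if_neg h]; simp [h]

/-- **`E_p ∧ E_{n−p} ≠ 0` whenever `C(n,p) ≠ 0` in `K`.** -/
theorem w_spike_mul_w_spike_ne_zero {p p' : ℕ} (hpp' : p + p' = n) (hc : (n.choose p : K) ≠ 0) :
    w K n n (fun j => if j = p then (1 : K) else 0) * w K n n (fun j => if j = p' then (1 : K) else 0) ≠ 0 := by
  rw [Ne, w_spike_mul_w_spike_eq_zero_iff, not_or]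
  exact ⟨fun h => h hpp', hc⟩

/-! ## §204. Expansion on spikes and non-degeneracy -/

/-- additivity over finite sums in the first window. -/
theorem apolar_finset_sum_left {ι : Type*} (s : Finset ι) (f : ι → ℕ → K) (m : ℕ) (q' : ℕ → K) :
    apolar K m (fun j => ∑ i ∈ s, f i j) q' = ∑ i ∈ s, apolar K m (f i) q' := by
  classical
  induction s using Finset.induction_on with
  | empty => simp only [Finset.sum_empty]; exact apolar_zero_seq_left K m q'
  | insert a s ha ih =>
    simp only [Finset.sum_insert ha]
    rw [← ih]
    exact apolar_add_left K m (f a) (fun j => ∑ i ∈ s, f i j) q'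

/-- **EXPANSION ON SPIKES: `apolar m q q′ = Σ_{p ≤ m} q_p · apolar m δ_p q′`.** -/
theorem apolar_eq_sum_spike_left (m : ℕ) (q q' : ℕ → K) :
    apolar K m q q' = ∑ p ∈ Finset.range (m + 1), q p * apolar K m (fun j => if j = p then (1 : K) else 0) q' := by
  have e : ∀ j ≤ m, q j = ∑ p ∈ Finset.range (m + 1), q p * (if j = p then (1 : K) else 0) := fun j hj => by
    rw [Finset.sum_eq_single j]
    · rw [if_pos rfl, mul_one]
    · intro p _ hp; rw [if_neg (Ne.symm hp), mul_zero]
    · intro h; exact absurd (Finset.mem_range.mpr (by omega)) h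
  rw [apolar_congr K m (q₂ := fun j => ∑ p ∈ Finset.range (m + 1), q p * (if j = p then (1 : K) else 0)) (q₂' := q') e (fun _ _ => rfl), apolar_finset_sum_left]
  exact Finset.sum_congr rfl fun p _ => apolar_smul_left K (q p) m _ q'

/-- **against a spike: `apolar m q δ_{p′} = (−1)^{m(m−1)/2} · (−1)^{m−p′} · C(m, m−p′) · q_{m−p′}`** for `p′ ≤ m` (only `q_{m−p′}` is seen). -/
theorem apolar_spike_right (m : ℕ) (q : ℕ → K) {p' : ℕ} (hp' : p' ≤ m) :
    apolar K m q (fun j => if j = p' then (1 : K) else 0) = (-1) ^ (m * (m - 1) / 2) * (-1) ^ (m - p') * (m.choose (m - p') : K) * q (m - p') := by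
  rw [apolar_eq_sum_spike_left, Finset.sum_eq_single (m - p')]
  · rw [apolar_spike_spike, if_pos (by omega)]; ring
  · intro p _ hp; rw [apolar_spike_spike, if_neg (by omega), mul_zero]
  · intro h; exact absurd (Finset.mem_range.mpr (by omega)) h

/-- **NON-DEGENERACY: if every `C(m,p)`, `p ≤ m`, is non-zero in `K` and `q ≢ 0` on `[0, m]`, then some spike pairs non-trivially with `q`.** -/
theorem apolar_nondegenerate {m : ℕ} (hK : ∀ p ≤ m, (m.choose p : K) ≠ 0) {q : ℕ → K} (hq : ∃ j ≤ m, q j ≠ 0) :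
    ∃ p' ≤ m, apolar K m q (fun j => if j = p' then (1 : K) else 0) ≠ 0 := by
  obtain ⟨j, hj, hqj⟩ := hq
  refine ⟨m - j, Nat.sub_le m j, ?_⟩
  rw [apolar_spike_right K m q (Nat.sub_le m j), Nat.sub_sub_self hj]
  exact mul_ne_zero (mul_ne_zero (mul_ne_zero (pow_ne_zero _ (neg_ne_zero.mpr one_ne_zero)) (pow_ne_zero _ (neg_ne_zero.mpr one_ne_zero))) (hK j hj)) hqj

/-! ## §205. No class is a Siegel form when the binomials are units -/

/-- **`w_n(q) ∈ SI_n` IFF `q ≡ 0` on `[0, n]`** when every `C(n,p)` is non-zero in `K` (G6: `SI_n = Ann_n(coSiegel_n)`; a class annihilating all classes is apolar to every spike). -/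
theorem w_mem_siegelIdeal_iff_window_zero (hK : ∀ p ≤ n, (n.choose p : K) ≠ 0) (q : ℕ → K) : w K n n q ∈ siegelIdeal K n n ↔ ∀ j ≤ n, q j = 0 := by
  rw [siegelIdeal_eq_Ann_coSiegel K (k := n) (j := n) rfl, mem_Ann]
  constructor
  · rintro ⟨-, h⟩
    by_contra hne
    push Not at hne
    obtain ⟨p', -, hp'⟩ := apolar_nondegenerate K hK hne
    refine hp' ?_
    have h0 := h _ (w_mem_coSiegel K (fun j => if j = p' then (1 : K) else 0))
    obtain ⟨c, hc, hcc⟩ := topCoeff_w_mul_w K (n := n)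
    rw [hcc, mul_eq_zero] at h0
    exact h0.resolve_left hc
  · intro h
    have hw : w K n n q = 0 := by rw [w_eq_of_agree K n (q' := fun _ => (0 : K)) (fun i hi => h i hi), w_zero]
    rw [hw]
    exact ⟨Submodule.zero_mem _, fun v _ => by rw [zero_mul, map_zero]⟩

/-- **NO NON-ZERO CLASS IS A SIEGEL FORM: `coSiegel_n ⊓ SI_n = ⊥` when every binomial `C(n,p)` is a unit in `K`** (e.g. characteristic `0` or `> n`; fails in characteristic `2` for `n = 2`,
where `E_1 = s_{01}`). -/
theorem coSiegel_inf_siegelIdeal_eq_bot (hK : ∀ p ≤ n, (n.choose p : K) ≠ 0) : coSiegel K n n ⊓ siegelIdeal K n n = ⊥ := by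
  rw [Submodule.eq_bot_iff]
  rintro f ⟨hf, hS⟩
  obtain ⟨q, rfl⟩ := exists_eq_w_of_mem_coSiegel K hf
  rw [w_eq_of_agree K n (q' := fun _ => (0 : K)) (fun i hi => (w_mem_siegelIdeal_iff_window_zero K hK q).mp hS i hi), w_zero]

end Summit.Ventures.HSemireg.Wedge.KernelDuality
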